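import Summits.CriticalPhenomena.PercolationContinuityZ3.Theorems.FK.DLRKernelSandwich
import Summits.CriticalPhenomena.PercolationContinuityZ3.Theorems.FK.InfiniteVolumeGibbs
import HarnessLib

/-!
# FK-continuity cell, FO-10a: every DLR random-cluster measure satisfies the free/wired sandwich —
# `IsDLRRandomCluster d p q P → FKGibbs d p q P` (Grimmett 2006, Lemma (4.14)(b) inside the DLR equation (4.30))

Registered R75 (cell INBOX l.5563, 2026-08-23); registry row FO-10a-g335d; label DLS-C (coordinator fk-4 g153).
Cell `fk-continuity` (bschramm), row FO-10a (domain-Markov + comparison layer over FO-06); support file for the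
FK-continuity transplant (`--supports stmt-CriticalPhenomena-4575`); builds on p205010 (kernel theorem, internal audit
signed; external expert review pending). Pure proofs; no definitions, no named facts, no sorries; general `d`.

The bridge between the cell's two notions of an infinite-volume random-cluster measure: FO-06b-6's DLR class
`IsDLRRandomCluster d p q P` (Grimmett's `R_{p,q}`, Def. (4.29): `∫ φ^ξ_{Λ,p,q}(A) P(dξ) = P(A)`) and FO-06a's sandwich
class `FKGibbs d p q P` (`φ⁰_Λ(A) P(H) ≤ P(A ∩ H) ≤ φ¹_Λ(A) P(H)` for increasing `E_Λ`-local `A` and local `H` off `E_Λ`).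
For `0 < p < 1`, `q ≥ 1` and `P` carried by lattice configurations, **`R_{p,q} ⊆` sandwich class**:

* `reachable_union_of_forall_reachable` — a walk of `η ∪ β` between vertices of `Λ` (`η` inside `E_Λ`, `β` lattice
  edges off `E_Λ`) is a succession of inside steps and outside excursions between vertices of `Λ`; so it survives
  replacing `β` by any `ζ` joining the same pairs of vertices of `Λ`;
* `exists_finset_forall_rcCondProb_eq` — hence for every lattice `ξ` there is a FINITE `ζ ⊆ ξ ∖ E_Λ` with
  `φ^ξ_{Λ,p,q} = φ^ζ_{Λ,p,q}` (the kernel sees `ξ` only through the partition of `Λ` it induces,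
  FO-06b-6 `rcCondProb_congr_of_forall_reachable_iff`; finitely many pairs, one finite path each);
* `rcCondLaw_inter_eq_indicator_mul_ofReal_sum` — `φ^ξ_Λ(A ∩ H) = 1_H(ξ) · ∑_{η ⊆ E_Λ, η ∈ A} φ^ξ_Λ(η)` for `A`
  determined by `E_Λ` and `H` determined off `E_Λ`;
* **`IsDLRRandomCluster.regionFreeReal_mul_le`, `IsDLRRandomCluster.le_regionWiredReal_mul`,
  `IsDLRRandomCluster.fkGibbs`** — the sandwich and the class inclusion, from the kernel sandwich of
  `DLRKernelSandwich.lean` integrated over `H` (`lintegral_mono_ae`).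

Consequence (with FO-10a-g335 `UniquenessOfNonPercolationTheta`, in `DLRUniqueness.lean`): when `θ¹(p,q) = 0` the DLR
class is the singleton `{φ⁰_{p,q}}` — Grimmett's `|R_{p,q}| = 1` (Thm. (5.33)(a)) as printed. Endpoints `p ∈ {0,1}` are
not treated (the kernel conditioning event has probability zero there); `q ≥ 1` is needed for the comparison.

## References

* G. Grimmett, *The Random-Cluster Model*, Springer 2006 (`book:grimmett2006-random-cluster-model`): Lemma (4.13),
  Lemma (4.14)(b) [PDF pp. 70–72]; Def. (4.29) eq. (4.30), Thm. (4.31) [PDF pp. 81–82]. [Grimmett2006]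
-/

noncomputable section

open MeasureTheory Set Filter
open scoped Topology ENNReal

namespace Summit.CriticalPhenomena.PercolationContinuityZ3.Theorems.FK

open Literature.Probability.Percolation Literature.Probability.LatticeModels

variable {d : ℕ}

/-! ### Outside excursions: replacing the outside configuration by one joining the same pairs of `Λ` -/

section Excursion

/-- **Inside steps and outside excursions.** Let `η` consist of pairs inside `Λ`, `β` of pairs NOT inside `Λ`
(no pair of `β` has both endpoints in `Λ`), and let `ζ` join every two vertices of `Λ` that `β` joins. Then two
vertices of `Λ` joined in `η ∪ β` are joined in `η ∪ ζ`. [cite: Grimmett2006, §4.2 (4.12)–(4.13) (the boundary condition as a partition of Λ)] -/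
theorem reachable_union_of_forall_reachable {Λ : Finset (Site d)} {η β ζ : BondConfig (Site d)}
    (hη : ∀ e ∈ η, ∀ x ∈ e, x ∈ Λ) (hβ : ∀ e ∈ β, ¬ ∀ x ∈ e, x ∈ Λ)
    (hP : ∀ a ∈ Λ, ∀ b ∈ Λ, (openGraph β).Reachable a b → (openGraph ζ).Reachable a b)
    {u v : Site d} (hu : u ∈ Λ) (hv : v ∈ Λ) (h : (openGraph (η ∪ β)).Reachable u v) :
    (openGraph (η ∪ ζ)).Reachable u v := by
  -- the invariant along a walk, read from its start `a`
  suffices key : ∀ (a : Site d) (w : (openGraph (η ∪ β)).Walk a v),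
      (a ∈ Λ → (openGraph (η ∪ ζ)).Reachable a v) ∧
        (a ∉ Λ → ∃ c ∈ Λ, (openGraph β).Reachable a c ∧ (openGraph (η ∪ ζ)).Reachable c v) from
    (key u h.some).1 hu
  intro a w
  clear hu h
  induction w with
  | nil => exact ⟨fun _ => SimpleGraph.Reachable.refl _, fun h => (h hv).elim⟩
  | @cons a a' _ hadj w' ih =>
    replace ih := ih hv
    rw [openGraph_adj] at hadj
    obtain ⟨he, hne⟩ := hadj
    have hmono : openGraph ζ ≤ openGraph (η ∪ ζ) := by
      intro x y hxy
      rw [openGraph_adj] at hxy ⊢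
      exact ⟨Or.inr hxy.1, hxy.2⟩
    -- an edge with an endpoint off `Λ` is an edge of `β`
    have hβ_of : a ∉ Λ ∨ a' ∉ Λ → s(a, a') ∈ β := by
      intro hout
      rcases he with heη | heβ
      · exfalso
        rcases hout with ha | ha'
        · exact ha (hη _ heη a (Sym2.mem_mk_left a a'))
        · exact ha' (hη _ heη a' (Sym2.mem_mk_right a a'))
      · exact heβ
    refine ⟨fun ha => ?_, fun ha => ?_⟩
    · -- `a ∈ Λ`
      by_cases ha' : a' ∈ Λ
      · -- inside step: the edge lies in `η` (a `β`-edge cannot have both endpoints in `Λ`)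
        have heη : s(a, a') ∈ η := by
          rcases he with heη | heβ
          · exact heη
          · exact (hβ _ heβ (fun x hx => by rcases Sym2.mem_iff.1 hx with rfl | rfl <;> assumption)).elim
        have hadj' : (openGraph (η ∪ ζ)).Adj a a' := by
          rw [openGraph_adj]; exact ⟨Or.inl heη, hne⟩
        exact hadj'.reachable.trans ((ih).1 ha')
      · -- an outside excursion starts: follow it to its return vertex `c ∈ Λ`
        obtain ⟨c, hc, hreach, hcv⟩ := (ih).2 ha'
        have hβe : s(a, a') ∈ β := hβ_of (Or.inr ha')
        have hac : (openGraph β).Reachable a c := by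
          refine SimpleGraph.Reachable.trans (SimpleGraph.Adj.reachable ?_) hreach
          rw [openGraph_adj]; exact ⟨hβe, hne⟩
        exact ((hP a ha c hc hac).mono hmono).trans hcv
    · -- `a ∉ Λ`: we are inside an excursion
      have hβe : s(a, a') ∈ β := hβ_of (Or.inl ha)
      have haa' : (openGraph β).Adj a a' := by rw [openGraph_adj]; exact ⟨hβe, hne⟩
      by_cases ha' : a' ∈ Λ
      · exact ⟨a', ha', haa'.reachable, (ih).1 ha'⟩
      · obtain ⟨c, hc, hreach, hcv⟩ := (ih).2 ha'
        exact ⟨c, hc, haa'.reachable.trans hreach, hcv⟩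

/-- **Finite reduction of the boundary condition**: for every lattice configuration `ξ` and finite region `Λ`
there is a FINITE configuration `ζ ⊆ ξ ∖ E_Λ` inducing the same specification kernel, `φ^ξ_{Λ,p,q} = φ^ζ_{Λ,p,q}`
(the kernel depends on `ξ` only through which vertices of `Λ` are joined off `E_Λ`; finitely many pairs, one finite
open path each). [cite: Grimmett2006, §4.2 (4.12)–(4.13) (the boundary condition as a partition of Λ)] -/
theorem exists_finset_forall_rcCondProb_eq (p q : ℝ) (Λ : Finset (Site d)) {ξ : BondConfig (Site d)}
    (hξE : ξ ⊆ (zdGraph d).edgeSet) :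
    ∃ ζ : Finset (Sym2 (Site d)), (↑ζ : BondConfig (Site d)) ⊆ ξ \ ↑(edgesIn (zdGraph d) Λ) ∧
      ∀ η ⊆ edgesIn (zdGraph d) Λ, rcCondProb p q Λ ξ η = rcCondProb p q Λ ↑ζ η := by
  classical
  set β : BondConfig (Site d) := ξ \ ↑(edgesIn (zdGraph d) Λ) with hβ
  -- for each pair of vertices joined in `β`, the edges of one chosen open path
  set W : Site d × Site d → Finset (Sym2 (Site d)) := fun uv =>
    if h : (openGraph β).Reachable uv.1 uv.2 then h.some.edges.toFinset else ∅ with hW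
  have hWβ : ∀ uv, (↑(W uv) : BondConfig (Site d)) ⊆ β := by
    intro uv e he
    rw [Finset.mem_coe] at he
    simp only [hW] at he
    split_ifs at he with h
    · have h1 := h.some.edges_subset_edgeSet (List.mem_toFinset.1 he)
      rw [openGraph, SimpleGraph.edgeSet_fromEdgeSet] at h1
      exact h1.1
    · simp at he
  set ζ := (Λ ×ˢ Λ).biUnion W with hζ
  have hζβ : (↑ζ : BondConfig (Site d)) ⊆ β := by
    intro e he
    rw [Finset.mem_coe, hζ, Finset.mem_biUnion] at he
    obtain ⟨uv, -, he⟩ := he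
    exact hWβ uv (Finset.mem_coe.2 he)
  refine ⟨ζ, hζβ, fun η hη => ?_⟩
  have hζU : (↑ζ : BondConfig (Site d)) \ ↑(edgesIn (zdGraph d) Λ) = ↑ζ := by
    refine sdiff_eq_left.2 (Set.disjoint_left.2 fun e he heU => ?_)
    exact (hζβ he).2 heU
  refine rcCondProb_congr_of_forall_reachable_iff (fun η' hη' u hu v hv => ?_) hη
  rw [hζU, ← hβ]
  -- the two outside configurations join the same pairs of `Λ`
  have hη'Λ : ∀ e ∈ (↑η' : BondConfig (Site d)), ∀ x ∈ e, x ∈ Λ := fun e he =>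
    (mem_edgesIn_iff.1 (hη' (Finset.mem_coe.1 he))).2
  have hβΛ : ∀ e ∈ β, ¬ ∀ x ∈ e, x ∈ Λ := by
    intro e he hall
    exact he.2 (Finset.mem_coe.2 (mem_edgesIn_iff.2 ⟨hξE he.1, hall⟩))
  constructor
  · refine reachable_union_of_forall_reachable hη'Λ hβΛ (fun a ha b hb hab => ?_) hu hv
    -- the chosen path from `a` to `b` has its edges in `ζ`
    have hWab : (↑(W (a, b)) : BondConfig (Site d)) ⊆ ↑ζ := by
      intro e he
      rw [Finset.mem_coe] at he ⊢
      exact Finset.mem_biUnion.2 ⟨(a, b), Finset.mem_product.2 ⟨ha, hb⟩, he⟩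
    have hw : ∀ e ∈ hab.some.edges, e ∈ (openGraph (↑ζ : BondConfig (Site d))).edgeSet := by
      intro e he
      have h1 := hab.some.edges_subset_edgeSet he
      rw [openGraph, SimpleGraph.edgeSet_fromEdgeSet] at h1 ⊢
      refine ⟨hWab ?_, h1.2⟩
      rw [Finset.mem_coe]
      simp only [hW, dif_pos hab]
      exact List.mem_toFinset.2 he
    exact ⟨hab.some.transfer _ hw⟩
  · exact fun h => h.mono (openGraph_mono (Set.union_subset_union_right _ hζβ))

end Excursion

/-! ### The kernel sandwich for every lattice boundary condition -/

section KernelSandwich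

open Finset

variable {p q : ℝ}

open Classical in
/-- **Lemma (4.14)(b) for the specification kernel, lower half**: for a lattice configuration `ξ` and an increasing
event `A` determined by `E_Λ`, `φ⁰_{Λ,p,q}(A) ≤ φ^ξ_{Λ,p,q}(A)` (`0 < p < 1`, `q ≥ 1`). [cite: Grimmett2006, Lemma (4.14)(b) with (4.12)–(4.13)] -/
theorem regionFreeReal_le_sum_rcCondProb (hp : p ∈ Set.Ioo (0 : ℝ) 1) (hq : 1 ≤ q) {Λ : Finset (Site d)}
    {ξ : BondConfig (Site d)} (hξE : ξ ⊆ (zdGraph d).edgeSet) {A : Set (BondConfig (Site d))} (hA : IsUpperSet A)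
    (hAΛ : DeterminedBy A ↑(edgesIn (zdGraph d) Λ)) :
    regionFreeReal d p q Λ A ≤
      ∑ η ∈ ((edgesIn (zdGraph d) Λ).powerset.filter
        (fun η : Finset (Sym2 (Site d)) => ((η : Set (Sym2 (Site d))) ∈ A))), rcCondProb p q Λ ξ η := by
  obtain ⟨ζ, hζβ, hζ⟩ := exists_finset_forall_rcCondProb_eq p q Λ hξE
  rw [Finset.sum_congr rfl fun η hη => hζ η (Finset.mem_powerset.1 (Finset.mem_filter.1 hη).1)]
  exact regionFreeReal_le_sum_rcCondProb_coe hp hq (fun e he => hξE (hζβ (Finset.mem_coe.2 he)).1)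
    (Finset.disjoint_left.2 fun e he heU => (hζβ (Finset.mem_coe.2 he)).2 (Finset.mem_coe.2 heU)) hA hAΛ

open Classical in
/-- **Lemma (4.14)(b) for the specification kernel, upper half**: `φ^ξ_{Λ,p,q}(A) ≤ φ¹_{Λ,p,q}(A)` likewise.
[cite: Grimmett2006, Lemma (4.14)(b) with (4.12)–(4.13)] -/
theorem sum_rcCondProb_le_regionWiredReal (hp : p ∈ Set.Ioo (0 : ℝ) 1) (hq : 1 ≤ q) {Λ : Finset (Site d)}
    {ξ : BondConfig (Site d)} (hξE : ξ ⊆ (zdGraph d).edgeSet) {A : Set (BondConfig (Site d))} (hA : IsUpperSet A)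
    (hAΛ : DeterminedBy A ↑(edgesIn (zdGraph d) Λ)) :
    ∑ η ∈ ((edgesIn (zdGraph d) Λ).powerset.filter
        (fun η : Finset (Sym2 (Site d)) => ((η : Set (Sym2 (Site d))) ∈ A))), rcCondProb p q Λ ξ η ≤
      regionWiredReal d p q Λ A := by
  obtain ⟨ζ, hζβ, hζ⟩ := exists_finset_forall_rcCondProb_eq p q Λ hξE
  rw [Finset.sum_congr rfl fun η hη => hζ η (Finset.mem_powerset.1 (Finset.mem_filter.1 hη).1)]
  exact sum_rcCondProb_coe_le_regionWiredReal hp hq (fun e he => hξE (hζβ (Finset.mem_coe.2 he)).1)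
    (Finset.disjoint_left.2 fun e he heU => (hζβ (Finset.mem_coe.2 he)).2 (Finset.mem_coe.2 heU)) hA hAΛ

open Classical in
/-- **The law `φ^ξ_Λ` on `A ∩ H`** for `A` determined by `E_Λ` and `H` determined by pairs off `E_Λ`:
`φ^ξ_Λ(A ∩ H) = 1_H(ξ) · ∑_{η ⊆ E_Λ, η ∈ A} φ^ξ_Λ(η)` (the law charges `η ∪ (ξ ∖ E_Λ)`, which lies in `H` iff `ξ` does
and in `A` iff `η` does). [cite: Grimmett2006, §4.2 (4.11)–(4.12)] -/
theorem rcCondLaw_inter_eq_indicator_mul_ofReal_sum (hp : p ∈ Set.Icc (0 : ℝ) 1) (hq : 0 < q)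
    (Λ : Finset (Site d)) (ξ : BondConfig (Site d)) {A H : Set (BondConfig (Site d))} {T : Set (Sym2 (Site d))}
    (hAΛ : DeterminedBy A ↑(edgesIn (zdGraph d) Λ)) (hT : Disjoint T ↑(edgesIn (zdGraph d) Λ))
    (hH : DeterminedBy H T) (hAm : MeasurableSet A) (hHm : MeasurableSet H) :
    rcCondLaw p q Λ ξ (A ∩ H) =
      H.indicator (fun _ => ENNReal.ofReal (∑ η ∈ ((edgesIn (zdGraph d) Λ).powerset.filter
        (fun η : Finset (Sym2 (Site d)) => ((η : Set (Sym2 (Site d))) ∈ A))), rcCondProb p q Λ ξ η)) ξ := by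
  -- where the law charges
  have hptH : ∀ η ∈ (edgesIn (zdGraph d) Λ).powerset,
      ((↑η : BondConfig (Site d)) ∪ (ξ \ ↑(edgesIn (zdGraph d) Λ)) ∈ H ↔ ξ ∈ H) := by
    intro η hη
    refine (determinedBy_iff _ _).1 hH _ _ ?_
    ext e
    simp only [Set.mem_inter_iff, Set.mem_union, Finset.mem_coe, Set.mem_sdiff]
    constructor
    · rintro ⟨h | h, heT⟩
      · exact (Set.disjoint_left.1 hT heT (Finset.mem_coe.2 (Finset.mem_powerset.1 hη h))).elim
      · exact ⟨h.1, heT⟩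
    · rintro ⟨h, heT⟩
      exact ⟨Or.inr ⟨h, fun heU => Set.disjoint_left.1 hT heT heU⟩, heT⟩
  have hptA : ∀ η ∈ (edgesIn (zdGraph d) Λ).powerset,
      ((↑η : BondConfig (Site d)) ∪ (ξ \ ↑(edgesIn (zdGraph d) Λ)) ∈ A ↔ (↑η : BondConfig (Site d)) ∈ A) := by
    intro η _
    refine (determinedBy_iff _ _).1 hAΛ _ _ ?_
    ext e
    simp only [Set.mem_inter_iff, Set.mem_union, Finset.mem_coe, Set.mem_sdiff]
    constructor
    · rintro ⟨h | h, heU⟩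
      · exact ⟨h, heU⟩
      · exact (h.2 heU).elim
    · rintro ⟨h, heU⟩
      exact ⟨Or.inl h, heU⟩
  rw [rcCondLaw_eq, Measure.finsetSum_apply]
  simp only [Measure.smul_apply, smul_eq_mul, Measure.dirac_apply' _ (hAm.inter hHm)]
  by_cases hξ : ξ ∈ H
  · rw [Set.indicator_of_mem hξ,
      ENNReal.ofReal_sum_of_nonneg (fun η _ => rcCondProb_nonneg hp hq Λ ξ η), Finset.sum_filter]
    refine Finset.sum_congr rfl fun η hη => ?_
    by_cases hA : (↑η : BondConfig (Site d)) ∈ A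
    · have hmem : ((↑η : BondConfig (Site d)) ∪ (ξ \ ↑(edgesIn (zdGraph d) Λ))) ∈ A ∩ H :=
        ⟨(hptA η hη).2 hA, (hptH η hη).2 hξ⟩
      rw [if_pos hA, Set.indicator_of_mem hmem, Pi.one_apply, mul_one]
    · have hnm : ((↑η : BondConfig (Site d)) ∪ (ξ \ ↑(edgesIn (zdGraph d) Λ))) ∉ A ∩ H :=
        fun h => hA ((hptA η hη).1 h.1)
      rw [if_neg hA, Set.indicator_of_notMem hnm, mul_zero]
  · rw [Set.indicator_of_notMem hξ]
    refine Finset.sum_eq_zero fun η hη => ?_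
    have hnm : ((↑η : BondConfig (Site d)) ∪ (ξ \ ↑(edgesIn (zdGraph d) Λ))) ∉ A ∩ H :=
      fun h => hξ ((hptH η hη).1 h.2)
    rw [Set.indicator_of_notMem hnm, mul_zero]

end KernelSandwich

/-! ### DLR measures satisfy the sandwich -/

section DLR

variable {p q : ℝ} {P : Measure (BondConfig (Site d))}

/-- **Lower sandwich for a DLR measure** (`0 < p < 1`, `q ≥ 1`, `P` carried by lattice configurations): for a finite
region `Λ`, an increasing event `A` determined by `E_Λ` and an event `H` determined by a finite pair set disjoint from
`E_Λ`, `φ⁰_{Λ,p,q}(A) · P(H) ≤ P(A ∩ H)`. [cite: Grimmett2006, Def. (4.29) eq. (4.30) with Lemma (4.14)(b)] -/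
theorem IsDLRRandomCluster.regionFreeReal_mul_le (hP : IsDLRRandomCluster d p q P) (hp : p ∈ Set.Ioo (0 : ℝ) 1)
    (hq : 1 ≤ q) (hE : ∀ᵐ ω ∂P, ω ⊆ (zdGraph d).edgeSet) (Λ : Finset (Site d)) {A H : Set (BondConfig (Site d))}
    (T : Finset (Sym2 (Site d))) (hA : IsUpperSet A) (hAΛ : DeterminedBy A ↑(edgesIn (zdGraph d) Λ))
    (hT : Disjoint (↑T : Set (Sym2 (Site d))) ↑(edgesIn (zdGraph d) Λ)) (hH : DeterminedBy H ↑T) :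
    regionFreeReal d p q Λ A * P.real H ≤ P.real (A ∩ H) := by
  classical
  haveI := hP.isProbabilityMeasure
  have hp' : p ∈ Set.Icc (0 : ℝ) 1 := ⟨hp.1.le, hp.2.le⟩
  have hq0 : 0 < q := one_pos.trans_le hq
  have hAm : MeasurableSet A := measurableSet_of_isLocalEvent_holds ⟨_, hAΛ⟩
  have hHm : MeasurableSet H := measurableSet_of_isLocalEvent_holds ⟨T, hH⟩
  set c := regionFreeReal d p q Λ A with hc
  have hdom : ∀ᵐ ξ ∂P, H.indicator (fun _ => ENNReal.ofReal c) ξ ≤ rcCondLaw p q Λ ξ (A ∩ H) := by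
    filter_upwards [hE] with ξ hξ
    rw [rcCondLaw_inter_eq_indicator_mul_ofReal_sum hp' hq0 Λ ξ hAΛ hT hH hAm hHm]
    by_cases hξH : ξ ∈ H
    · rw [Set.indicator_of_mem hξH, Set.indicator_of_mem hξH]
      exact ENNReal.ofReal_le_ofReal (regionFreeReal_le_sum_rcCondProb hp hq hξ hA hAΛ)
    · rw [Set.indicator_of_notMem hξH, Set.indicator_of_notMem hξH]
  have h1 : ENNReal.ofReal c * P H ≤ P (A ∩ H) := by
    rw [← hP.lintegral_rcCondLaw_eq Λ (hAm.inter hHm), ← lintegral_indicator_const hHm]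
    exact lintegral_mono_ae hdom
  have h2 := ENNReal.toReal_mono (measure_ne_top P _) h1
  rwa [ENNReal.toReal_mul, ENNReal.toReal_ofReal (regionFreeReal_nonneg p q Λ A)] at h2

/-- **Upper sandwich for a DLR measure**: `P(A ∩ H) ≤ φ¹_{Λ,p,q}(A) · P(H)` under the same hypotheses.
[cite: Grimmett2006, Def. (4.29) eq. (4.30) with Lemma (4.14)(b)] -/
theorem IsDLRRandomCluster.le_regionWiredReal_mul (hP : IsDLRRandomCluster d p q P) (hp : p ∈ Set.Ioo (0 : ℝ) 1)
    (hq : 1 ≤ q) (hE : ∀ᵐ ω ∂P, ω ⊆ (zdGraph d).edgeSet) (Λ : Finset (Site d)) {A H : Set (BondConfig (Site d))}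
    (T : Finset (Sym2 (Site d))) (hA : IsUpperSet A) (hAΛ : DeterminedBy A ↑(edgesIn (zdGraph d) Λ))
    (hT : Disjoint (↑T : Set (Sym2 (Site d))) ↑(edgesIn (zdGraph d) Λ)) (hH : DeterminedBy H ↑T) :
    P.real (A ∩ H) ≤ regionWiredReal d p q Λ A * P.real H := by
  classical
  haveI := hP.isProbabilityMeasure
  have hp' : p ∈ Set.Icc (0 : ℝ) 1 := ⟨hp.1.le, hp.2.le⟩
  have hq0 : 0 < q := one_pos.trans_le hq
  have hAm : MeasurableSet A := measurableSet_of_isLocalEvent_holds ⟨_, hAΛ⟩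
  have hHm : MeasurableSet H := measurableSet_of_isLocalEvent_holds ⟨T, hH⟩
  set c := regionWiredReal d p q Λ A with hc
  have hc0 : 0 ≤ c := by rw [hc, regionWiredReal]; exact measureReal_nonneg
  have hdom : ∀ᵐ ξ ∂P, rcCondLaw p q Λ ξ (A ∩ H) ≤ H.indicator (fun _ => ENNReal.ofReal c) ξ := by
    filter_upwards [hE] with ξ hξ
    rw [rcCondLaw_inter_eq_indicator_mul_ofReal_sum hp' hq0 Λ ξ hAΛ hT hH hAm hHm]
    by_cases hξH : ξ ∈ H
    · rw [Set.indicator_of_mem hξH, Set.indicator_of_mem hξH]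
      exact ENNReal.ofReal_le_ofReal (sum_rcCondProb_le_regionWiredReal hp hq hξ hA hAΛ)
    · rw [Set.indicator_of_notMem hξH, Set.indicator_of_notMem hξH]
  have h1 : P (A ∩ H) ≤ ENNReal.ofReal c * P H := by
    rw [← hP.lintegral_rcCondLaw_eq Λ (hAm.inter hHm), ← lintegral_indicator_const hHm]
    exact lintegral_mono_ae hdom
  have h2 := ENNReal.toReal_mono (ENNReal.mul_ne_top ENNReal.ofReal_ne_top (measure_ne_top P _)) h1
  rwa [ENNReal.toReal_mul, ENNReal.toReal_ofReal hc0] at h2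

/-- **`R_{p,q} ⊆` the sandwich class**: every DLR random-cluster measure carried by lattice configurations satisfies the
cell's interface `FKGibbs` (`0 < p < 1`, `q ≥ 1`, every `d`). [cite: Grimmett2006, Def. (4.29), Thm. (4.31) and Lemma (4.14)(b)] -/
theorem IsDLRRandomCluster.fkGibbs (hP : IsDLRRandomCluster d p q P) (hp : p ∈ Set.Ioo (0 : ℝ) 1) (hq : 1 ≤ q)
    (hE : ∀ᵐ ω ∂P, ω ⊆ (zdGraph d).edgeSet) : FKGibbs d p q P where
  isProbabilityMeasure := hP.isProbabilityMeasure
  ae_subset_edgeSet := hE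
  free_mul_le Λ _ _ T hA hAΛ hT hH := hP.regionFreeReal_mul_le hp hq hE Λ T hA hAΛ hT hH
  le_wired_mul Λ _ _ T hA hAΛ hT hH := hP.le_regionWiredReal_mul hp hq hE Λ T hA hAΛ hT hH

end DLR

end Summit.CriticalPhenomena.PercolationContinuityZ3.Theorems.FK

end
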